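import Mathlib
import Literature.Analysis.PDE.ABPHessian
import Summits.NavierStokesRegularity.NavierStokesRegularity.Theorems.UnthreadedDoorFluxStarvedDipoleAncientEndgameTools
import HarnessLib

/-!
# Route `UnthreadedDoor`, crux `PoloidalLiouville` (stmt-NavierStokesRegularity-1222), wall W1 — crux idea
# «flux-starved-dipoles» (ns-idea-15, `Cruxes/PoloidalLiouville/FluxStarvedDipoleSketch.lean`):
# the ANCIENT ENDGAME of K1′ (`DipoleNeverAncient`) by a classical comparison argument

Card §Proof step 5′ closes K1′ through a distributional subsolution (semiconvexity across the kinks of `‖A‖`, removal of the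
polar line in `ℝ⁵`, Moser's parabolic mean-value inequality).  THIS FILE replaces that route by an elementary CLASSICAL
comparison, which is what makes the step kernel-sized:

* the smooth quantity `u = ‖A‖²/r²` satisfies, at every point where the amplitude identity
  `⟪A″ + (2/r)A′ − (2/r²)A − ∂ₜA, A⟫ = 0` holds (i.e. wherever `A ≠ 0`), the pointwise inequality
  `∂ₜu ≤ u″ + (4/r)u′` with defect `(2/r²)‖A′ − A/r‖²` (`subsolution_pointwise`);
* `H(τ,r) = K/(r² + 2τ) + ε/r³` is a STRICT supersolution of the same operator (`∂τH − H″ − (4/r)H′ = 16Kτ/(r²+2τ)³ > 0`);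
* a positive maximum of `u − H` over a compact box `[t₀,t₁] × [ρ₀,ρ₁]` (the box is chosen so that `u − H ≤ 0` on its parabolic
  boundary, using only `‖A‖ ≤ C`: the `ε/r³` term beats `C²/r²` near the polar line, `K/(r²+2τ)` beats it far out and at the
  initial time) sits at a point where `A ≠ 0`, where the two inequalities and the first/second-order conditions of a maximum are
  contradictory;
* hence `‖A(t₁,r₁)‖²/r₁² ≤ K_ε/(2(t₁ − t₀ + 1)) + ε/r₁³` for every `t₀ < t₁`; `t₀ → −∞`, then `ε → 0`: `A ≡ 0`
  (`eq_zero_of_amplitudeIdentity`).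

No distributions, no mean-value inequality, no regularity of `‖A‖` across its zero set is needed.  HONEST LABEL: dipole (`l = 1`)
stratum of the LINEAR kinematic shadow of W1 (critic V28: information-grade, W1 movement 0); `PoloidalLiouville` (1222), its wall
`stub_scalarLiouville` and the summit stay OPEN; NO Navier–Stokes regularity statement is proved.
`--supports stmt-NavierStokesRegularity-1222` (helper).  [folklore]
-/

noncomputable section

-- the summit and its single sub-problem share the name (CONVENTIONS §1)
set_option linter.dupNamespace false

open Set Filter Topology InnerProductSpace
open scoped RealInnerProductSpace

namespace Summit.NavierStokesRegularity.NavierStokesRegularity.Theorems.PoloidalLiouville.FluxStarvedDipole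

/-! ### The comparison argument -/

section Comparison

variable {F : Type*} [NormedAddCommGroup F] [InnerProductSpace ℝ F]

/-- COMPARISON ON A TIME WINDOW (the heart of K1′).  `A` jointly `C²` on `(−∞,0) × (0,∞)`, `‖A‖ ≤ C` (`C ≥ 1`), and the
amplitude identity `⟪A″ + (2/r)A′ − (2/r²)A − ∂ₜA, A⟫ = 0` wherever `A ≠ 0`.  Then for `t₀ < t₁ < 0`, `ε > 0` and
`K = 2C² + 2C⁶/ε²`: `‖A(t,r)‖²/r² ≤ K/(r² + 2(t − t₀ + 1)) + ε/r³` on `[t₀,t₁] × (0,∞)`.  Proof: a positive maximum of the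
difference over the box `[t₀,t₁] × [ε/C², 2(t₁−t₀+1)+1]` (outside which, and at `t = t₀`, the difference is `≤ 0` by `‖A‖ ≤ C`
alone) lies where `A ≠ 0`; there `subsolution_pointwise`, `superH_strict` and the first/second-order conditions of a maximum
(`deriv_nonneg_of_isMaxOn_right`, Fermat, `Literature.Analysis.PDE.ABP.deriv_deriv_nonpos_of_isLocalMax`) are
contradictory. [folklore] -/
theorem normSq_div_sq_le_superH (A : ℝ → ℝ → F) {C ε t₀ t₁ : ℝ} (hC : 1 ≤ C) (hε : 0 < ε)
    (ht₀₁ : t₀ < t₁) (ht₁ : t₁ < 0)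
    (hA : ContDiffOn ℝ 2 (Function.uncurry A) (Set.Iio 0 ×ˢ Set.Ioi 0))
    (hb : ∀ t < 0, ∀ r > 0, ‖A t r‖ ≤ C)
    (hid : ∀ t < 0, ∀ r > 0, A t r ≠ 0 →
      ⟪iteratedDeriv 2 (A t) r + (2 / r) • deriv (A t) r - (2 / r ^ 2) • A t r
          - fderiv ℝ (Function.uncurry A) (t, r) ((1 : ℝ), (0 : ℝ)), A t r⟫ = 0) :
    ∀ t ∈ Set.Icc t₀ t₁, ∀ r > 0,
      ‖A t r‖ ^ 2 / r ^ 2 ≤ ((2 * C ^ 2 + 2 * C ^ 6 / ε ^ 2) / (r ^ 2 + 2 * (t - t₀ + 1)) + ε / r ^ 3) := by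
  set K : ℝ := 2 * C ^ 2 + 2 * C ^ 6 / ε ^ 2 with hK
  have hC0 : 0 < C := by linarith
  have hC2 : 0 < C ^ 2 := by positivity
  have hK2 : 2 * C ^ 2 < K := by
    have : 0 < 2 * C ^ 6 / ε ^ 2 := by positivity
    linarith
  have hKpos : 0 < K := by linarith
  -- the `C²/r²` bound
  have hu : ∀ t < 0, ∀ r > 0, ‖A t r‖ ^ 2 / r ^ 2 ≤ C ^ 2 / r ^ 2 := by
    intro t ht r hr
    have h1 : ‖A t r‖ ^ 2 ≤ C ^ 2 := pow_le_pow_left₀ (norm_nonneg _) (hb t ht r hr) 2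
    exact div_le_div_of_nonneg_right h1 (by positivity)
  -- the box
  set ρ₀ : ℝ := ε / C ^ 2 with hρ₀
  set ρ₁ : ℝ := 2 * (t₁ - t₀ + 1) + 1 with hρ₁
  have hρ₀pos : 0 < ρ₀ := by positivity
  -- edge facts (E0): near the polar line
  have hE0 : ∀ t ∈ Set.Icc t₀ t₁, ∀ r, 0 < r → r ≤ ρ₀ →
      ‖A t r‖ ^ 2 / r ^ 2 < (K / (r ^ 2 + 2 * (t - t₀ + 1)) + ε / r ^ 3) := by
    intro t ht r hr hrρ
    have htn : t < 0 := lt_of_le_of_lt ht.2 ht₁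
    have hτ : 0 < t - t₀ + 1 := by linarith [ht.1]
    have h1 : C ^ 2 / r ^ 2 ≤ ε / r ^ 3 := by
      rw [div_le_div_iff₀ (by positivity) (by positivity)]
      have h2 : C ^ 2 * r ≤ ε := by
        have := (le_div_iff₀ hC2).mp (hρ₀ ▸ hrρ)
        linarith [mul_comm r (C ^ 2)]
      nlinarith [pow_pos hr 2]
    have h3 : 0 < K / (r ^ 2 + 2 * (t - t₀ + 1)) := by positivity
    linarith [hu t htn r hr]
  -- (E1): far out
  have hE1 : ∀ t ∈ Set.Icc t₀ t₁, ∀ r, ρ₁ ≤ r →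
      ‖A t r‖ ^ 2 / r ^ 2 < (K / (r ^ 2 + 2 * (t - t₀ + 1)) + ε / r ^ 3) := by
    intro t ht r hrρ
    have htn : t < 0 := lt_of_le_of_lt ht.2 ht₁
    have hτ : 0 < t - t₀ + 1 := by linarith [ht.1]
    have hρ₁1 : 1 ≤ ρ₁ := by rw [hρ₁]; linarith
    have hr1 : 1 ≤ r := le_trans hρ₁1 hrρ
    have hr : 0 < r := by linarith
    have hr2 : 2 * (t - t₀ + 1) ≤ r ^ 2 := by
      have : 2 * (t - t₀ + 1) ≤ ρ₁ := by rw [hρ₁]; linarith [ht.2]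
      nlinarith
    have h1 : C ^ 2 / r ^ 2 < K / (r ^ 2 + 2 * (t - t₀ + 1)) := by
      rw [div_lt_div_iff₀ (by positivity) (by positivity)]
      nlinarith
    have h3 : 0 < ε / r ^ 3 := by positivity
    linarith [hu t htn r hr]
  -- (E2): initial time
  have hE2 : ∀ r, 0 < r → ‖A t₀ r‖ ^ 2 / r ^ 2 < (K / (r ^ 2 + 2 * (t₀ - t₀ + 1)) + ε / r ^ 3) := by
    intro r hr
    rw [show t₀ - t₀ + 1 = (1 : ℝ) by ring]
    have ht₀mem : t₀ ∈ Set.Icc t₀ t₁ := ⟨le_rfl, ht₀₁.le⟩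
    rcases le_or_gt r ρ₀ with hle | hlt
    · simpa using hE0 t₀ ht₀mem r hr hle
    · have htn : t₀ < 0 := lt_trans ht₀₁ ht₁
      have hεr : ε < C ^ 2 * r := by
        have := (div_lt_iff₀ hC2).mp (hρ₀ ▸ hlt)
        linarith [mul_comm r (C ^ 2)]
      have hsq : ε ^ 2 < (C ^ 2 * r) ^ 2 := by
        exact pow_lt_pow_left₀ hεr hε.le two_ne_zero
      have h1 : C ^ 2 / r ^ 2 < K / (r ^ 2 + 2 * 1) := by
        rw [div_lt_div_iff₀ (by positivity) (by positivity)]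
        have hKr : K * r ^ 2 = 2 * C ^ 2 * r ^ 2 + 2 * C ^ 2 * ((C ^ 2 * r) ^ 2 / ε ^ 2) := by
          rw [hK]
          field_simp
        have h4 : 1 < (C ^ 2 * r) ^ 2 / ε ^ 2 := by
          rw [one_lt_div (by positivity)]
          exact hsq
        nlinarith
      have h3 : 0 < ε / r ^ 3 := by positivity
      linarith [hu t₀ htn r hr]
  -- suppose the claim fails somewhere
  by_contra hcon
  push Not at hcon
  obtain ⟨t', ht', r', hr', hlt⟩ := hcon
  have hr'₀ : ρ₀ < r' := by
    by_contra h
    exact absurd (hE0 t' ht' r' hr' (not_lt.mp h)) (not_lt.mpr hlt.le)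
  have hr'₁ : r' < ρ₁ := by
    by_contra h
    exact absurd (hE1 t' ht' r' (not_lt.mp h)) (not_lt.mpr hlt.le)
  -- the difference on the box
  set D : ℝ × ℝ → ℝ := fun p => ‖A p.1 p.2‖ ^ 2 / p.2 ^ 2 - (K / (p.2 ^ 2 + 2 * (p.1 - t₀ + 1)) + ε / p.2 ^ 3)
    with hD
  set Kc : Set (ℝ × ℝ) := Set.Icc t₀ t₁ ×ˢ Set.Icc ρ₀ ρ₁ with hKc
  have hKc_cpt : IsCompact Kc := isCompact_Icc.prod isCompact_Icc
  have hKc_sub : Kc ⊆ Set.Iio 0 ×ˢ Set.Ioi 0 := by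
    rintro ⟨t, r⟩ ⟨ht, hr⟩
    exact ⟨lt_of_le_of_lt ht.2 ht₁, lt_of_lt_of_le hρ₀pos hr.1⟩
  have hcont : ContinuousOn D Kc := by
    have hAc : ContinuousOn (fun p : ℝ × ℝ => A p.1 p.2) Kc := hA.continuousOn.mono hKc_sub
    have hr0 : ∀ p ∈ Kc, (p : ℝ × ℝ).2 ≠ 0 := by
      rintro ⟨t, r⟩ ⟨-, hr⟩
      exact (lt_of_lt_of_le hρ₀pos hr.1).ne'
    have hden : ∀ p ∈ Kc, (p : ℝ × ℝ).2 ^ 2 + 2 * (p.1 - t₀ + 1) ≠ 0 := by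
      rintro ⟨t, r⟩ ⟨ht, -⟩
      have : 0 < t - t₀ + 1 := by linarith [ht.1]
      positivity
    have h1 : ContinuousOn (fun p : ℝ × ℝ => ‖A p.1 p.2‖ ^ 2 / p.2 ^ 2) Kc :=
      (hAc.norm.pow 2).div ((continuous_snd.pow 2).continuousOn) (fun p hp => pow_ne_zero 2 (hr0 p hp))
    have h2 : ContinuousOn (fun p : ℝ × ℝ => K / (p.2 ^ 2 + 2 * (p.1 - t₀ + 1))) Kc :=
      continuousOn_const.div (by fun_prop) hden
    have h3 : ContinuousOn (fun p : ℝ × ℝ => ε / p.2 ^ 3) Kc :=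
      continuousOn_const.div (by fun_prop) (fun p hp => pow_ne_zero 3 (hr0 p hp))
    exact h1.sub (h2.add h3)
  obtain ⟨p, hpK, hpmax⟩ := hKc_cpt.exists_isMaxOn ⟨(t', r'), ⟨ht', hr'₀.le, hr'₁.le⟩⟩ hcont
  obtain ⟨ts, rs⟩ := p
  obtain ⟨hts, hrs⟩ := hpK
  have hDpos : 0 < D (ts, rs) := by
    have h1 : 0 < D (t', r') := by simp only [hD]; linarith
    exact lt_of_lt_of_le h1 (hpmax ⟨ht', hr'₀.le, hr'₁.le⟩)
  have hrs0 : 0 < rs := lt_of_lt_of_le hρ₀pos hrs.1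
  have htsn : ts < 0 := lt_of_le_of_lt hts.2 ht₁
  have hτ : 0 < ts - t₀ + 1 := by linarith [hts.1]
  have hDval : D (ts, rs) = ‖A ts rs‖ ^ 2 / rs ^ 2 - (K / (rs ^ 2 + 2 * (ts - t₀ + 1)) + ε / rs ^ 3) := rfl
  -- position of the maximum: interior in `r`, not at the initial time, and `A ≠ 0` there
  have hrs₀ : ρ₀ < rs := by
    rcases lt_or_eq_of_le hrs.1 with h | h
    · exact h
    · exfalso
      have := hE0 ts hts rs hrs0 h.symm.le
      linarith
  have hrs₁ : rs < ρ₁ := by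
    rcases lt_or_eq_of_le hrs.2 with h | h
    · exact h
    · exfalso
      have := hE1 ts hts rs h.symm.le
      linarith
  have hts₀ : t₀ < ts := by
    rcases lt_or_eq_of_le hts.1 with h | h
    · exact h
    · exfalso
      have h1 := hE2 rs hrs0
      rw [h] at h1
      have e : ts - t₀ + 1 = ts - ts + 1 := by rw [h]
      rw [e] at hDval
      linarith
  have hHpos : 0 < (K / (rs ^ 2 + 2 * (ts - t₀ + 1)) + ε / rs ^ 3) := by
    positivity
  have hA0 : A ts rs ≠ 0 := by
    intro h0
    rw [h0, norm_zero] at hDval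
    have : D (ts, rs) < 0 := by
      rw [hDval]
      simp only [ne_eq, OfNat.ofNat_ne_zero, not_false_eq_true, zero_pow, zero_div, zero_sub, Left.neg_neg_iff]
      exact hHpos
    linarith
  -- regularity at the maximum
  have hU : Set.Iio (0 : ℝ) ×ˢ Set.Ioi (0 : ℝ) ∈ 𝓝 (ts, rs) :=
    (isOpen_Iio.prod isOpen_Ioi).mem_nhds ⟨htsn, hrs0⟩
  have hslice : ContDiffOn ℝ 2 (A ts) (Set.Ioi 0) := by
    have hf : ContDiffOn ℝ 2 (fun ρ : ℝ => (ts, ρ)) (Set.Ioi 0) := contDiffOn_const.prodMk contDiffOn_id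
    exact hA.comp hf (fun ρ hρ => ⟨htsn, hρ⟩)
  have hd1 : ∀ ρ : ℝ, 0 < ρ → HasDerivAt (A ts) (deriv (A ts) ρ) ρ := fun ρ hρ =>
    ((hslice.differentiableOn (by norm_num)).differentiableAt (Ioi_mem_nhds hρ)).hasDerivAt
  have hslice1 : ContDiffOn ℝ 1 (deriv (A ts)) (Set.Ioi 0) :=
    hslice.deriv_of_isOpen isOpen_Ioi (by norm_num)
  have hd2 : HasDerivAt (deriv (A ts)) (deriv (deriv (A ts)) rs) rs :=
    ((hslice1.differentiableOn (by norm_num)).differentiableAt (Ioi_mem_nhds hrs0)).hasDerivAt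
  have hdt : HasDerivAt (fun s => A s rs) (fderiv ℝ (Function.uncurry A) (ts, rs) ((1 : ℝ), (0 : ℝ))) ts := by
    have hd : DifferentiableAt ℝ (Function.uncurry A) (ts, rs) :=
      (hA.differentiableOn (by norm_num)).differentiableAt hU
    have hc : HasDerivAt (fun s : ℝ => (s, rs)) ((1 : ℝ), (0 : ℝ)) ts :=
      (hasDerivAt_id ts).prodMk (hasDerivAt_const ts rs)
    exact hd.hasFDerivAt.comp_hasDerivAt ts hc
  have h2eq : iteratedDeriv 2 (A ts) rs = deriv (deriv (A ts)) rs := by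
    rw [show (2 : ℕ) = 1 + 1 from rfl, iteratedDeriv_succ, iteratedDeriv_one]
  -- names for the values
  set a : F := A ts rs with ha
  set a₁ : F := deriv (A ts) rs with ha₁
  set a₂ : F := deriv (deriv (A ts)) rs with ha₂
  set adot : F := fderiv ℝ (Function.uncurry A) (ts, rs) ((1 : ℝ), (0 : ℝ)) with hadot
  set τs : ℝ := ts - t₀ + 1 with hτs
  set ut : ℝ := 2 * ⟪adot, a⟫ / rs ^ 2 with hut
  set ur : ℝ := 2 * ⟪a₁, a⟫ / rs ^ 2 - 2 * ‖a‖ ^ 2 / rs ^ 3 with hur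
  set urr : ℝ := (2 * ⟪a₂, a⟫ + 2 * ‖a₁‖ ^ 2) / rs ^ 2 - 8 * ⟪a₁, a⟫ / rs ^ 3 + 6 * ‖a‖ ^ 2 / rs ^ 4
    with hurr
  set H2 : ℝ := -(2 * K) / (rs ^ 2 + 2 * τs) ^ 2 + 8 * K * rs ^ 2 / (rs ^ 2 + 2 * τs) ^ 3 + 12 * ε / rs ^ 5
    with hH2
  set H1 : ℝ := -(2 * K * rs) / (rs ^ 2 + 2 * τs) ^ 2 - 3 * ε / rs ^ 4 with hH1
  set Ht : ℝ := -(2 * K) / (rs ^ 2 + 2 * τs) ^ 2 with hHt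
  -- (P) the subsolution inequality at the maximum
  have hP : ut ≤ urr + 4 / rs * ur := by
    have hid' := hid ts htsn rs hrs0 hA0
    rw [h2eq] at hid'
    exact subsolution_pointwise a a₁ a₂ adot hrs0 hid'
  -- (S) the strict supersolution inequality
  have hS : H2 + 4 / rs * H1 < Ht := superH_strict hKpos hτ hrs0
  -- (T) the time condition
  have hT : 0 ≤ ut - Ht := by
    have hf1 : HasDerivAt (fun s => ‖A s rs‖ ^ 2 / rs ^ 2) ut ts := hasDerivAt_normSq_div_const _ rs hdt
    have hin : HasDerivAt (fun s : ℝ => s - t₀ + 1) 1 ts := by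
      simpa using ((hasDerivAt_id ts).sub_const t₀).add_const 1
    have hf2 : HasDerivAt (fun s => (K / (rs ^ 2 + 2 * (s - t₀ + 1)) + ε / rs ^ 3)) (Ht) ts := by
      have h := (hasDerivAt_superH_τ K ε (r := rs) hτ).comp ts hin
      simpa [Function.comp_def, hτs] using h
    have hf : HasDerivAt (fun s => D (s, rs)) (ut - Ht) ts := hf1.sub hf2
    refine deriv_nonneg_of_isMaxOn_right hts₀ ?_ hf
    intro s hs
    exact hpmax ⟨⟨hs.1, le_trans hs.2 hts.2⟩, hrs⟩
  -- (R) the space conditions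
  have hg : HasDerivAt (fun ρ => D (ts, ρ)) (ur - H1) rs :=
    (hasDerivAt_normSq_div_sq (hd1 rs hrs0) hrs0.ne').sub (hasDerivAt_superH_r K ε hτ hrs0.ne')
  have hloc : IsLocalMax (fun ρ => D (ts, ρ)) rs := by
    filter_upwards [Icc_mem_nhds hrs₀ hrs₁] with ρ hρ
    exact hpmax ⟨hts, hρ⟩
  have hR1 : ur - H1 = 0 := hloc.hasDerivAt_eq_zero hg
  have hR2 : urr - H2 ≤ 0 := by
    have hderiv_eq : deriv (fun ρ => D (ts, ρ)) =ᶠ[𝓝 rs]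
        fun ρ => (2 * ⟪deriv (A ts) ρ, A ts ρ⟫ / ρ ^ 2 - 2 * ‖A ts ρ‖ ^ 2 / ρ ^ 3)
          - (-(2 * K * ρ) / (ρ ^ 2 + 2 * τs) ^ 2 - 3 * ε / ρ ^ 4) := by
      filter_upwards [Ioi_mem_nhds hrs0] with ρ hρ
      exact ((hasDerivAt_normSq_div_sq (hd1 ρ hρ) (ne_of_gt hρ)).sub
        (hasDerivAt_superH_r K ε hτ (ne_of_gt hρ))).deriv
    have hψ : HasDerivAt
        (fun ρ => (2 * ⟪deriv (A ts) ρ, A ts ρ⟫ / ρ ^ 2 - 2 * ‖A ts ρ‖ ^ 2 / ρ ^ 3)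
          - (-(2 * K * ρ) / (ρ ^ 2 + 2 * τs) ^ 2 - 3 * ε / ρ ^ 4))
        (urr - H2) rs :=
      (hasDerivAt_normSq_div_sq_deriv (hd1 rs hrs0) hd2 hrs0.ne').sub (hasDerivAt_superH1_r K ε hτ hrs0.ne')
    have h2 : deriv (deriv (fun ρ => D (ts, ρ))) rs = urr - H2 := by
      rw [hderiv_eq.deriv_eq, hψ.deriv]
    have hle := Literature.Analysis.PDE.ABP.deriv_deriv_nonpos_of_isLocalMax hloc (by rw [hg.deriv, hR1])
      hg.continuousAt
    rwa [h2] at hle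
  -- contradiction
  have hur_eq : 4 / rs * ur = 4 / rs * H1 := by
    rw [show ur = H1 by linarith]
  linarith

/-- **K1′ ENDGAME — ANCIENT AMPLITUDE LIOUVILLE.**  If `A : (−∞,0) × (0,∞) → F` is jointly `C²`, bounded (`‖A‖ ≤ C`), and
satisfies the amplitude identity `⟪A″ + (2/r)A′ − (2/r²)A − ∂ₜA, A⟫ = 0` wherever `A ≠ 0` (with `A″ = iteratedDeriv 2 (A t) r`,
`A′ = deriv (A t) r`, `∂ₜA = D(uncurry A)(t,r)[(1,0)]`, exactly as delivered by `amplitudeIdentity_window_all`, p838751), then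
`A ≡ 0`.  From `normSq_div_sq_le_superH`: `‖A(t₁,r₁)‖²/r₁² ≤ K_ε/(2(t₁ − t₀ + 1)) + ε/r₁³` for all `t₀ < t₁`; `t₀ → −∞`, then
`ε → 0`.  (Replaces the card's distributional-subsolution / parabolic-mean-value route for §Proof step 5′.) [folklore] -/
theorem eq_zero_of_amplitudeIdentity (A : ℝ → ℝ → F) {C : ℝ}
    (hA : ContDiffOn ℝ 2 (Function.uncurry A) (Set.Iio 0 ×ˢ Set.Ioi 0))
    (hb : ∀ t < 0, ∀ r > 0, ‖A t r‖ ≤ C)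
    (hid : ∀ t < 0, ∀ r > 0, A t r ≠ 0 →
      ⟪iteratedDeriv 2 (A t) r + (2 / r) • deriv (A t) r - (2 / r ^ 2) • A t r
          - fderiv ℝ (Function.uncurry A) (t, r) ((1 : ℝ), (0 : ℝ)), A t r⟫ = 0) :
    ∀ t < 0, ∀ r > 0, A t r = 0 := by
  intro t₁ ht₁ r₁ hr₁
  set C' : ℝ := max C 1 with hC'
  have hC'1 : 1 ≤ C' := le_max_right _ _
  have hb' : ∀ t < 0, ∀ r > 0, ‖A t r‖ ≤ C' := fun t ht r hr => le_trans (hb t ht r hr) (le_max_left _ _)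
  by_contra hne
  set u₁ : ℝ := ‖A t₁ r₁‖ ^ 2 / r₁ ^ 2 with hu₁
  have hu₁pos : 0 < u₁ := by
    have : 0 < ‖A t₁ r₁‖ := norm_pos_iff.mpr hne
    positivity
  set ε : ℝ := u₁ * r₁ ^ 3 / 4 with hε
  have hεpos : 0 < ε := by positivity
  set K : ℝ := 2 * C' ^ 2 + 2 * C' ^ 6 / ε ^ 2 with hK
  have hKpos : 0 < K := by
    have : 0 < C' := by linarith
    positivity
  set T : ℝ := 2 * K / u₁ with hT
  have hTpos : 0 < T := by positivity
  have hmain := normSq_div_sq_le_superH A hC'1 hεpos (by linarith : t₁ - T < t₁) ht₁ hA hb' hid t₁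
    ⟨by linarith, le_rfl⟩ r₁ hr₁
  have hτ : t₁ - (t₁ - T) + 1 = T + 1 := by ring
  rw [hτ] at hmain
  -- `(K / (r₁ ^ 2 + 2 * (T+1)) + ε / r₁ ^ 3) ≤ K/(2(T+1)) + ε/r₁³ < u₁/4 + u₁/4`
  have h1 : K / (r₁ ^ 2 + 2 * (T + 1)) < u₁ / 4 := by
    have h2 : K / (r₁ ^ 2 + 2 * (T + 1)) ≤ K / (2 * T) :=
      div_le_div_of_nonneg_left hKpos.le (by positivity) (by nlinarith [sq_nonneg r₁])
    have h3 : K / (2 * T) = u₁ / 4 := by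
      rw [hT]
      field_simp
      ring
    have h4 : K / (r₁ ^ 2 + 2 * (T + 1)) < K / (2 * T) :=
      div_lt_div_of_pos_left hKpos (by positivity) (by nlinarith [sq_nonneg r₁])
    linarith
  have h5 : ε / r₁ ^ 3 = u₁ / 4 := by
    rw [hε]
    field_simp
  have h6 : (K / (r₁ ^ 2 + 2 * (T + 1)) + ε / r₁ ^ 3) < u₁ := by
    linarith
  exact absurd (lt_of_le_of_lt hmain h6) (lt_irrefl _)

end Comparison

end Summit.NavierStokesRegularity.NavierStokesRegularity.Theorems.PoloidalLiouville.FluxStarvedDipole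

end
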